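import Mathlib
import HarnessLib
import Summits.HubbardSuperconductivity.HubbardSuperconductivity.Theorems.KLProgrammePerturbedFermiCurveGradedPerOrder
import Summits.HubbardSuperconductivity.HubbardSuperconductivity.Theorems.KLProgrammeKLRegimeCountertermFrameCurveLipschitz

/-!
# The frame's Fermi-point map: the four GRADED curve jets in CLOSED FORM from the frame sizes `A, A₃, A₄` («(C1)-DEEP supplier», file 3b)

Cell `gate-hubbard-kl`, seat hubbard-kl-k3c3-p3 (g11; row «implicit-function / monotonicity route»), `--supports stmt-HubbardSuperconductivity-20437`;
pen (R79).  Composition of k3c3-p3 g2's sharp radius tower (…HigherDerivsFrame: `abs_deriv_frameRadius_le_uniform`, `abs_deriv_two/three/four_frameRadius_le`,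
LINEAR in the top-order sizes `A₃ = ‖D³ frameShift K‖`, `A₄ = ‖D⁴ frameShift K‖`) with file 3a (`fermiPointLp_graded_jets_fun`): for a frame with the
lineage's `C²` data (`‖Dʲ frameShift K‖ ≤ A`, `j ≤ 2`, `2A < Dt_min`, margins) and top sizes `A₃, A₄`, at every angle

  `‖γ′‖ ≤ D₁(A)`, `‖γ″‖ ≤ D₂(A)`, `‖γ‴‖ ≤ D₃(A, A₃)`, `‖γ⁗‖ ≤ D₄(A, A₃, A₄)`   (`γ θ = toLp 2 (klFermiPoint μ K θ)`)

with `D₃` affine in `A₃` and `D₄` affine in `A₃, A₄` (`frame_graded_curve_jets`).  At the flow frame `K_{n+1}` the sizes are `A = O(Gfr·(|U| + U² + c/log 4))`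
(n-free), `A₃ ≤ (Gfr₃/3)U²4^{n+1}`, `A₄ ≤ (Gfr₄/15)U²16^{n+1}` (`flowFrame_sizes_closed`, …JacksonRemainderScaleLaw), so `D₁, D₂` are n-FREE and the growth
sits in `D₃, D₄` only — the `hD` of `flowPiece_reading_remainder_jets_oneCall_bell`.  Proved; no definitions; nothing about the Hubbard model.
-/

noncomputable section

namespace Summit.HubbardSuperconductivity.HubbardSuperconductivity.Theorems.PerturbedFermiCurve

set_option linter.dupNamespace false -- summit = problem name (single-conjunct summit), D-0017

open Real Set Finset
open Literature.MathematicalPhysics.QuantumLattice Literature.MathematicalPhysics.QuantumLattice.BandSectorCounting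
open Summit.HubbardSuperconductivity.HubbardSuperconductivity.Theorems.DispersionFlow
open Summit.HubbardSuperconductivity.HubbardSuperconductivity.Theorems.KLRegimeSplit

section Frame

variable {a b : ℝ} (B : BandBounds a b) {K : TrigPolyC4v} {A : ℝ}
  (hA : ∀ p : Momentum, ∀ j ≤ 2, ‖iteratedFDeriv ℝ j (frameShift K) p‖ ≤ A) (hADt : 2 * A < B.Dtmin)
  {μ : ℝ} (hlo : a ≤ μ - A) (hhi : μ + A ≤ b)
include B hA hADt hlo hhi

/-- **The frame's radius tower in `iteratedDeriv` form, orders `0…4`**, from the `C²` size `A` and the top sizes `A₃, A₄`: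
`|u| ≤ π√2`, `|u′| ≤ U₁ := (4+2A)π√2/(Dt−2A)`, `|u″| ≤ U₂ := ((4+4A)(U₁+π√2)² + (4+2A)(2U₁+π√2))/(Dt−2A)`,
`|u‴| ≤ U₃ := ((4+8A₃)(U₁+π√2)³ + 3(4+4A)(U₁+π√2)(U₂+2U₁+π√2) + (4+2A)(3U₂+3U₁+π√2))/(Dt−2A)`,
`|u⁗| ≤ U₄ := ((4+16A₄)K₁⁴ + 6(4+8A₃)K₁²K₂ + 3(4+4A)K₂² + 4(4+4A)K₁K₃ + (4+2A)(4U₃+6U₂+4U₁+π√2))/(Dt−2A)` (`K₁ = U₁+π√2`, `K₂ = U₂+2U₁+π√2`,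
`K₃ = U₃+3U₂+3U₁+π√2`). -/
theorem frame_radius_tower_iteratedDeriv {A₃ A₄ : ℝ} (hA₃ : ∀ p : Momentum, ‖iteratedFDeriv ℝ 3 (frameShift K) p‖ ≤ A₃)
    (hA₄ : ∀ p : Momentum, ‖iteratedFDeriv ℝ 4 (frameShift K) p‖ ≤ A₄) (θ : ℝ) :
    let u := perturbedFermiRadius (fun p : Fin 2 → ℝ => -K.eval p) μ
    let s := π * Real.sqrt 2
    let U₁ := (4 + 2 * A) * s / (B.Dtmin - 2 * A)
    let U₂ := ((4 + 4 * A) * (U₁ + s) ^ 2 + (4 + 2 * A) * (2 * U₁ + s)) / (B.Dtmin - 2 * A)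
    let U₃ := ((4 + 8 * A₃) * (U₁ + s) ^ 3 + 3 * (4 + 4 * A) * (U₁ + s) * (U₂ + 2 * U₁ + s) + (4 + 2 * A) * (3 * U₂ + 3 * U₁ + s)) /
      (B.Dtmin - 2 * A)
    let U₄ := ((4 + 16 * A₄) * (U₁ + s) ^ 4 + 6 * (4 + 8 * A₃) * (U₁ + s) ^ 2 * (U₂ + 2 * U₁ + s) + 3 * (4 + 4 * A) * (U₂ + 2 * U₁ + s) ^ 2 +
        4 * (4 + 4 * A) * (U₁ + s) * (U₃ + 3 * U₂ + 3 * U₁ + s) + (4 + 2 * A) * (4 * U₃ + 6 * U₂ + 4 * U₁ + s)) / (B.Dtmin - 2 * A)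
    |iteratedDeriv 0 u θ| ≤ s ∧ |iteratedDeriv 1 u θ| ≤ U₁ ∧ |iteratedDeriv 2 u θ| ≤ U₂ ∧ |iteratedDeriv 3 u θ| ≤ U₃ ∧ |iteratedDeriv 4 u θ| ≤ U₄ := by
  intro u s U₁ U₂ U₃ U₄
  have h0 : |iteratedDeriv 0 u θ| ≤ s := by
    rw [iteratedDeriv_zero]
    have hpos := frameRadius_pos B hA hlo hhi θ
    have hle := frameRadius_le B hA hlo hhi θ
    rw [abs_of_pos hpos]; exact hle
  have e1 : iteratedDeriv 1 u θ = deriv u θ := by rw [iteratedDeriv_one]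
  have e2 : iteratedDeriv 2 u θ = deriv (deriv u) θ := by rw [iteratedDeriv_eq_iterate]; rfl
  have e3 : iteratedDeriv 3 u θ = deriv (deriv (deriv u)) θ := by rw [iteratedDeriv_eq_iterate]; rfl
  have e4 : iteratedDeriv 4 u θ = deriv (deriv (deriv (deriv u))) θ := by rw [iteratedDeriv_eq_iterate]; rfl
  have h1 : |deriv u θ| ≤ U₁ := abs_deriv_frameRadius_le_uniform B hA hADt hlo hhi θ
  have h2 : |deriv (deriv u) θ| ≤ U₂ := abs_deriv_two_frameRadius_le B hA hADt hlo hhi h1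
  have h3 : |deriv (deriv (deriv u)) θ| ≤ U₃ := abs_deriv_three_frameRadius_le B hA hADt hlo hhi hA₃ h1 h2
  have h4 : |deriv (deriv (deriv (deriv u))) θ| ≤ U₄ := abs_deriv_four_frameRadius_le B hA hADt hlo hhi hA₃ hA₄ h1 h2 h3
  exact ⟨h0, by rw [e1]; exact h1, by rw [e2]; exact h2, by rw [e3]; exact h3, by rw [e4]; exact h4⟩

/-- **THE FRAME'S GRADED CURVE JETS IN CLOSED FORM.**  With `U₀ = π√2` and `U₁…U₄` as in `frame_radius_tower_iteratedDeriv`: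
`‖γ′(θ)‖ ≤ 2(U₀+U₁)`, `‖γ″(θ)‖ ≤ 2(U₀+2U₁+U₂)`, `‖γ‴(θ)‖ ≤ 2(U₀+3U₁+3U₂+U₃)`, `‖γ⁗(θ)‖ ≤ 2(U₀+4U₁+6U₂+4U₃+U₄)` for
`γ θ = toLp 2 (klFermiPoint μ K θ)` — packaged as the `hD` hypothesis (`∀ i, 1 ≤ i → i ≤ 4 → ‖γ^{(i)}(θ)‖ ≤ D i`) of the graded (C1) door.
`D 1, D 2` depend on `A` only; `D 3` is affine in `A₃`; `D 4` is affine in `A₃, A₄`. -/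
theorem frame_graded_curve_jets {A₃ A₄ : ℝ} (hA₃ : ∀ p : Momentum, ‖iteratedFDeriv ℝ 3 (frameShift K) p‖ ≤ A₃)
    (hA₄ : ∀ p : Momentum, ‖iteratedFDeriv ℝ 4 (frameShift K) p‖ ≤ A₄) (θ : ℝ) :
    let s := π * Real.sqrt 2
    let U₁ := (4 + 2 * A) * s / (B.Dtmin - 2 * A)
    let U₂ := ((4 + 4 * A) * (U₁ + s) ^ 2 + (4 + 2 * A) * (2 * U₁ + s)) / (B.Dtmin - 2 * A)
    let U₃ := ((4 + 8 * A₃) * (U₁ + s) ^ 3 + 3 * (4 + 4 * A) * (U₁ + s) * (U₂ + 2 * U₁ + s) + (4 + 2 * A) * (3 * U₂ + 3 * U₁ + s)) /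
      (B.Dtmin - 2 * A)
    let U₄ := ((4 + 16 * A₄) * (U₁ + s) ^ 4 + 6 * (4 + 8 * A₃) * (U₁ + s) ^ 2 * (U₂ + 2 * U₁ + s) + 3 * (4 + 4 * A) * (U₂ + 2 * U₁ + s) ^ 2 +
        4 * (4 + 4 * A) * (U₁ + s) * (U₃ + 3 * U₂ + 3 * U₁ + s) + (4 + 2 * A) * (4 * U₃ + 6 * U₂ + 4 * U₁ + s)) / (B.Dtmin - 2 * A)
    ∀ i, 1 ≤ i → i ≤ 4 → ‖iteratedDeriv i (fun θ : ℝ => (WithLp.toLp 2 (klFermiPoint μ K θ) : Momentum)) θ‖ ≤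
      (fun i : ℕ => if i = 1 then 2 * (s + U₁) else if i = 2 then 2 * (s + 2 * U₁ + U₂)
        else if i = 3 then 2 * (s + 3 * U₁ + 3 * U₂ + U₃) else 2 * (s + 4 * U₁ + 6 * U₂ + 4 * U₃ + U₄)) i := by
  intro s U₁ U₂ U₃ U₄
  obtain ⟨h0, h1, h2, h3, h4⟩ := frame_radius_tower_iteratedDeriv B hA hADt hlo hhi hA₃ hA₄ θ
  have hU : ∀ k ≤ 4, |iteratedDeriv k (perturbedFermiRadius (fun p : Fin 2 → ℝ => -K.eval p) μ) θ| ≤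
      (fun k : ℕ => if k = 0 then s else if k = 1 then U₁ else if k = 2 then U₂ else if k = 3 then U₃ else U₄) k := by
    intro k hk
    interval_cases k
    · simpa using h0
    · simpa using h1
    · simpa using h2
    · simpa using h3
    · simpa using h4
  have h := fermiPointLp_graded_jets_fun B hA hADt hlo hhi hU
  intro i hi1 hi4
  have hi := h i hi1 hi4
  interval_cases i <;> simpa using hi

end Frame

end Summit.HubbardSuperconductivity.HubbardSuperconductivity.Theorems.PerturbedFermiCurve

end
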